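import Mathlib
import HarnessLib

/-!
# `NoHeavyLowerTail` (crux stmt-CriticalPhenomena-4575), antithetic vdBHK programme: the OUTER-PAIR TRANSFER LEMMA — the general pendant-atom rearrangement
# functional `R_U` transfers antipodal Kleitman (uniformly for wedges, zones, twins read as pendant atoms, multi-top and deep steps)

Support file (seat `prim-ineq-gen-7` gen 57; `--supports stmt-CriticalPhenomena-4575`).  No `sorry`, no definitions.  Memo:
run/shared/lean/prim/prim-ineq-gen-7/FINDING-NEST-g57.md §5; companions `AntitheticZoneTransfer` (the one-top case in four-sheet form) and
`AntitheticWedgeTransfer` (g51, the half case).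

SETTING.  A PENDANT-ATOM extension `P = P′ + v` (`v` a new minimal element with strict up-set `U`, `U ∩ min P′ = ∅`; by the NEST-POINT REDUCTION of the memo,
CONJECTURE Cβ is equivalent to the statement that these steps preserve antipodal Kleitman when the atom sets of `U` are nested) has colouring poset
`T = Ω_P = I ⊔ O₀ ⊔ O₁` where `O₀ = {v red, U blue}`, `O₁ = {v blue, U red}` (the OUTER PAIR; on it every element of `U` is dead) and `I` is the rest.  Both
`O₀` and `O₁` are induced copies of `Y := Ω_{P′ ∖ U}`, every relation `O₀ → O₁` is a `Y`-relation, the colour swap `ι` of `T` preserves `I` and maps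
`(O₀, y) ↦ (O₁, j y)` (`j` the colour swap of `Y`).  So an up-set of `T` is a triple `(A_I, A₀, A₁)` with `A₀, A₁` up-sets of `Y` (and further pattern
conditions that play no role here), and
  `AK_T(A,B) = [#(A_I ∩ B_I) − #(A_I ∩ ι B_I)] + #(A₀ ∩ B₀) + #(A₁ ∩ B₁) − #(A₀ ∩ j B₁) − #(A₁ ∩ j B₀)`.
THE FUNCTIONAL `R_U` replaces `ι` on the outer pair by the SAME-POINT map `(O₀,y) ↔ (O₁,y)`:
  `R_U(A,B) = [#(A_I ∩ B_I) − #(A_I ∩ ι B_I)] + #(A₀ ∩ B₀) + #(A₁ ∩ B₁) − #(A₀ ∩ B₁) − #(A₁ ∩ B₀)`.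
* `AntitheticOuterPair.outer_pair_transfer` — **`R_U(A,B) ≥ 0` and AK of `Y` (up-set form) ⟹ `AK_T(A,B) ≥ 0`**, for arbitrary finsets `A_I, B_I` of any
  type `I` with any self-map `ι`, and `Y`-up-sets `A₀, A₁, B₀, B₁`; the proof is the identity `AK_T − R_U = AK_Y(A₀,B₁) + AK_Y(A₁,B₀)`.
  SPECIAL CASES: `U = {x}` a hat over an atom — the rearrangement inequality (R) and `wedge_transfer` (g50/g51); `U = {t}` a top over a down-set — ZR and
  `zone_transfer` (this generation); `U = ↑°d` — a certificate for the twin of `d` DIFFERENT from g56's twin slack inequality (it certifies the twin of the W-fence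
  at its middle atom, where TSI = −2: exact, 9,445,156 up-sets, memo §5); `U` an antichain of tops / a deep up-set — the remaining step types of the
  nest-point reduction.  EXACT CENSUS (memo §5): `R_U` has minimum exactly 0 for all 42 pendant-atom instances with `|P| ≤ 5`; kit j311191 (`|P| = 6`).
-/

namespace Summit.CriticalPhenomena.PercolationContinuityZ3.Theorems

open Finset

namespace AntitheticOuterPair

variable {I Y : Type*} [DecidableEq I] [DecidableEq Y]

/-- **OUTER-PAIR TRANSFER.**  `Y` a partial order, AK in up-set form for the self-map `j` (`hAK`); `A₀, A₁, B₀, B₁` up-sets of `Y` (the outer traces of two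
up-sets of the pendant-atom extension), `A_I, B_I` arbitrary finsets of the inner part with any self-map `ι`.  If the pendant-atom functional is nonnegative,
`#(A_I ∩ ι B_I) + #(A₀ ∩ B₁) + #(A₁ ∩ B₀) ≤ #(A_I ∩ B_I) + #(A₀ ∩ B₀) + #(A₁ ∩ B₁)` (`hR`), then the antipodal-Kleitman inequality of the extension holds:
`#(A_I ∩ ι B_I) + #(A₀ ∩ j B₁) + #(A₁ ∩ j B₀) ≤ #(A_I ∩ B_I) + #(A₀ ∩ B₀) + #(A₁ ∩ B₁)`. [this work] -/
theorem outer_pair_transfer [PartialOrder Y] (ι : I → I) (j : Y → Y)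
    (hAK : ∀ V W : Finset Y, (∀ x y, x ≤ y → x ∈ V → y ∈ V) → (∀ x y, x ≤ y → x ∈ W → y ∈ W) →
      (V ∩ W.image j).card ≤ (V ∩ W).card)
    (AI BI : Finset I) (A₀ A₁ B₀ B₁ : Finset Y)
    (hA₀ : ∀ x y, x ≤ y → x ∈ A₀ → y ∈ A₀) (hA₁ : ∀ x y, x ≤ y → x ∈ A₁ → y ∈ A₁)
    (hB₀ : ∀ x y, x ≤ y → x ∈ B₀ → y ∈ B₀) (hB₁ : ∀ x y, x ≤ y → x ∈ B₁ → y ∈ B₁)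
    (hR : (AI ∩ BI.image ι).card + (A₀ ∩ B₁).card + (A₁ ∩ B₀).card ≤ (AI ∩ BI).card + (A₀ ∩ B₀).card + (A₁ ∩ B₁).card) :
    (AI ∩ BI.image ι).card + (A₀ ∩ B₁.image j).card + (A₁ ∩ B₀.image j).card ≤ (AI ∩ BI).card + (A₀ ∩ B₀).card + (A₁ ∩ B₁).card := by
  have ak1 := hAK A₀ B₁ hA₀ hB₁
  have ak2 := hAK A₁ B₀ hA₁ hB₀
  omega

/-- **OUTER-PAIR TRANSFER, all up-sets.**  If `R_U ≥ 0` holds for every admissible pair of trace-triples (any predicate `adm` implying that the outer traces are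
`Y`-up-sets) and `Y` is AK, then every admissible pair satisfies the AK inequality of the extension — the PENDANT-ATOM TRANSFER THEOREM of the memo (§5) in
kernel form: `R_U ≥ 0 ∧ AK(Ω_{P′∖U}) ⟹ AK(Ω_{P′+v})`, modulo the colouring dictionary. [this work] -/
theorem outer_pair_transfer_all [PartialOrder Y] (ι : I → I) (j : Y → Y)
    (hAK : ∀ V W : Finset Y, (∀ x y, x ≤ y → x ∈ V → y ∈ V) → (∀ x y, x ≤ y → x ∈ W → y ∈ W) →
      (V ∩ W.image j).card ≤ (V ∩ W).card)
    (adm : Finset I → Finset Y → Finset Y → Prop)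
    (hadm₀ : ∀ AI A₀ A₁, adm AI A₀ A₁ → ∀ x y, x ≤ y → x ∈ A₀ → y ∈ A₀)
    (hadm₁ : ∀ AI A₀ A₁, adm AI A₀ A₁ → ∀ x y, x ≤ y → x ∈ A₁ → y ∈ A₁)
    (hR : ∀ AI A₀ A₁ BI B₀ B₁, adm AI A₀ A₁ → adm BI B₀ B₁ →
      (AI ∩ BI.image ι).card + (A₀ ∩ B₁).card + (A₁ ∩ B₀).card ≤ (AI ∩ BI).card + (A₀ ∩ B₀).card + (A₁ ∩ B₁).card)
    (AI : Finset I) (A₀ A₁ : Finset Y) (BI : Finset I) (B₀ B₁ : Finset Y) (hA : adm AI A₀ A₁) (hB : adm BI B₀ B₁) :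
    (AI ∩ BI.image ι).card + (A₀ ∩ B₁.image j).card + (A₁ ∩ B₀.image j).card ≤ (AI ∩ BI).card + (A₀ ∩ B₀).card + (A₁ ∩ B₁).card :=
  outer_pair_transfer ι j hAK AI BI A₀ A₁ B₀ B₁ (hadm₀ AI A₀ A₁ hA) (hadm₁ AI A₀ A₁ hA) (hadm₀ BI B₀ B₁ hB) (hadm₁ BI B₀ B₁ hB)
    (hR AI A₀ A₁ BI B₀ B₁ hA hB)

end AntitheticOuterPair

end Summit.CriticalPhenomena.PercolationContinuityZ3.Theorems
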